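import Literature.AlgebraicGeometry.FundamentalGroup.HypersurfaceComplementMeridians
import Literature.AlgebraicGeometry.Dimension.HypersurfaceIdentityPrinciple
import Mathlib.Algebra.MvPolynomial.Nilpotent
import Mathlib.Topology.Baire.Lemmas
import Mathlib.Topology.Baire.CompleteMetrizable
import HarnessLib

/-!
# Generic lines for the complement of an affine hypersurface: simple roots on single components

Topic `Literature/AlgebraicGeometry/FundamentalGroup`.  Algebraic input of the Zariski–van Kampen
generation theorem (`HypersurfaceComplementMeridiansGenerate`): for irreducible, pairwise
non-associated `h₁, …, hₘ ∈ ℂ[xᵢ : i ∈ ι]`, a line `c ↦ b + c v` is **good** (`LineGood h b v`) if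
every root `c` of every restriction `c ↦ hⱼ(b + c v)` is SIMPLE (`Σ_k ∂_k hⱼ(b + cv) v_k ≠ 0`, the
transversality of the disc `c ↦ b + c v` to `V(hⱼ)` required of a meridian, file
`HypersurfaceComplementMeridians`) and is a root of no other `hᵢ` — so that the small circles of the
line around its intersections with `H = ⋃ V(hⱼ)` ARE meridians.

* `lineRestr v h ∈ (ℂ[b])[X]` — the universal restriction `h(b + X v)` to the lines of direction
  `v`, with `eval_eval_lineRestr` (`= h(b + c v)`), the chain rule `eval_eval_derivative_lineRestr`
  (`d/dc h(b + cv) = Σ_k ∂_k h(b + cv) v_k`), and `irreducible_lineRestr`: for `h` irreducible,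
  `lineRestr v h` is irreducible (it is the image of `C h` under the shear automorphism
  `b ↦ b + c v` of `ℂ[c, b]`);
* **`exists_polynomial_lineGood`** — for every direction `v` there is a NON-ZERO polynomial `P_v(b)`
  such that the line `(b, v)` is good whenever `P_v(b) ≠ 0`: `P_v` is a product of resultants
  `Res_X(𝔣ⱼ, 𝔣ⱼ')`, `Res_X(𝔣ᵢ, 𝔣ⱼ)` (`𝔣ⱼ = lineRestr v hⱼ`; Bézout `𝔣 p + 𝔣' q = Res`, Mathlib
  `Polynomial.exists_mul_add_mul_eq_C_resultant`), non-zero because a vanishing resultant against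
  the irreducible `𝔣ⱼ` would give `𝔣ⱼ ∣ 𝔣ⱼ'` resp. `𝔣ᵢ ~ 𝔣ⱼ` (the tree's
  `Polynomial.dvd_of_resultant_eq_zero_of_irreducible`, Gauss's lemma);
* **`exists_generic_basePoint`** — hence (Baire) every non-empty open set of `ℂ^ι` contains a base
  point `b` all of whose lines in a countable dense set of directions are good.

Everything is proved; no named facts.  (Shimada's transversal discs exist generically by Sard /
Bertini; here the genericity is made algebraic and explicit for straight lines.)

## References

* I. Shimada, Int. J. Math. 21 (2010), §3 (transversal discs, lassos). [Shimada2010ZvK]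
* I. R. Shafarevich, *Basic Algebraic Geometry* 1, I §3.1 (resultants). [Shafarevich1994]
-/

noncomputable section

open MvPolynomial
open scoped Polynomial

namespace Literature.AlgebraicGeometry.FundamentalGroup

variable {ι : Type}

/-! ### Restriction of a polynomial to the lines of a fixed direction -/

section LineRestriction

variable (v : ι → ℂ)

/-- **The universal restriction to the lines of direction `v`**: `h ↦ h(b + X v) ∈ (ℂ[b])[X]`
(`X k ↦ C(X k) + C(C v_k) X`). [cite: Shimada2010ZvK, §3 (transversal discs `δ(c) = y + c v`)] -/
def lineRestr : MvPolynomial ι ℂ →ₐ[ℂ] (MvPolynomial ι ℂ)[X] :=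
  MvPolynomial.aeval fun k => Polynomial.C (X k) + Polynomial.C (C (v k)) * Polynomial.X

/-- `lineRestr` on a variable. [cite: Shimada2010ZvK, §3 (transversal discs)] -/
@[simp] theorem lineRestr_X (k : ι) :
    lineRestr v (X k) = Polynomial.C (X k) + Polynomial.C (C (v k)) * Polynomial.X :=
  MvPolynomial.aeval_X _ _

/-- `lineRestr` on a constant. [cite: Shimada2010ZvK, §3 (transversal discs)] -/
@[simp] theorem lineRestr_C (a : ℂ) : lineRestr v (C a) = Polynomial.C (C a) := by
  rw [lineRestr, MvPolynomial.aeval_C, Polynomial.algebraMap_apply, MvPolynomial.algebraMap_eq]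

/-- **Evaluation**: `(lineRestr v h)(b)(c) = h(b + c v)`. [cite: Shimada2010ZvK, §3 (transversal discs)] -/
theorem eval_eval_lineRestr (b : ι → ℂ) (c : ℂ) (f : MvPolynomial ι ℂ) :
    Polynomial.eval c ((lineRestr v f).map (MvPolynomial.eval b)) = MvPolynomial.eval (b + c • v) f := by
  induction f using MvPolynomial.induction_on with
  | C a => simp
  | add p q hp hq => simp only [map_add, Polynomial.map_add, Polynomial.eval_add, hp, hq]
  | mul_X p k hp =>
    simp only [map_mul, Polynomial.map_mul, Polynomial.eval_mul, hp, lineRestr_X, Polynomial.map_add,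
      Polynomial.map_C, MvPolynomial.eval_X, MvPolynomial.eval_C, Polynomial.map_X, Polynomial.eval_add,
      Polynomial.eval_C, Polynomial.eval_X, Pi.add_apply, Pi.smul_apply, smul_eq_mul]
    ring

/-- **Chain rule**: `(lineRestr v h)' = Σ_k v_k · lineRestr v (∂_k h)`. [cite: Shimada2010ZvK, §3 (transversality of a disc)] -/
theorem derivative_lineRestr [Fintype ι] (f : MvPolynomial ι ℂ) :
    Polynomial.derivative (lineRestr v f) = ∑ k, Polynomial.C (C (v k)) * lineRestr v (pderiv k f) := by
  induction f using MvPolynomial.induction_on with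
  | C a => simp
  | add p q hp hq =>
    simp only [map_add, hp, hq, mul_add, Finset.sum_add_distrib]
  | mul_X p k hp =>
    have hd : Polynomial.derivative (lineRestr v (X k)) = Polynomial.C (C (v k)) := by
      rw [lineRestr_X]; simp
    rw [map_mul, Polynomial.derivative_mul, hp, hd]
    simp_rw [pderiv_mul, map_add, map_mul, mul_add, Finset.sum_add_distrib]
    congr 1
    · rw [Finset.sum_mul]
      exact Finset.sum_congr rfl fun i _ => by ring
    · rw [Finset.sum_eq_single k (fun i _ hik => by
        rw [pderiv_X_of_ne (Ne.symm hik), map_zero, mul_zero, mul_zero])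
        (fun h => absurd (Finset.mem_univ k) h), pderiv_X_self, map_one, mul_one]
      ring

/-- **Evaluation of the chain rule**: `d/dc h(b + c v) = Σ_k ∂_k h(b + cv) v_k` — the transversality
expression of `Meridian.transversal`. [cite: Shimada2010ZvK, §3 (transversality of a disc)] -/
theorem eval_eval_derivative_lineRestr [Fintype ι] (b : ι → ℂ) (c : ℂ) (f : MvPolynomial ι ℂ) :
    Polynomial.eval c ((Polynomial.derivative (lineRestr v f)).map (MvPolynomial.eval b)) =
      ∑ k, MvPolynomial.eval (b + c • v) (pderiv k f) * v k := by
  rw [derivative_lineRestr, Polynomial.map_sum, Polynomial.eval_finsetSum]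
  refine Finset.sum_congr rfl fun k _ => ?_
  rw [Polynomial.map_mul, Polynomial.eval_mul, Polynomial.map_C, Polynomial.eval_C, MvPolynomial.eval_C,
    eval_eval_lineRestr, mul_comm]

/-! ### `lineRestr v h` is irreducible for `h` irreducible -/

/-- The shear `b_k ↦ b_k + v_k c`, `c ↦ c` of `ℂ[c, b]` (`c = X none`, `b_k = X (some k)`).
[folklore] -/
def shear : MvPolynomial (Option ι) ℂ →ₐ[ℂ] MvPolynomial (Option ι) ℂ :=
  MvPolynomial.aeval fun o => Option.elim o (X none) fun k => X (some k) + C (v k) * X none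

/-- The shear fixes `c`. [folklore] -/
@[simp] private theorem shear_X_none : shear v (X none) = X none := by
  rw [shear, aeval_X]; rfl

/-- The shear on `b_k`. [folklore] -/
@[simp] private theorem shear_X_some (k : ι) : shear v (X (some k)) = X (some k) + C (v k) * X none := by
  rw [shear, aeval_X]; rfl

/-- Shears of opposite directions are inverse. [folklore] -/
private theorem shear_comp_shear_neg (w : ι → ℂ) : (shear w).comp (shear (-w)) = AlgHom.id ℂ _ := by
  refine MvPolynomial.algHom_ext fun o => ?_
  cases o with
  | none => simp
  | some k =>
    simp only [AlgHom.comp_apply, shear_X_some, map_add, map_mul, MvPolynomial.algHom_C, shear_X_none,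
      AlgHom.id_apply, Pi.neg_apply, map_neg, MvPolynomial.algebraMap_eq]
    ring

/-- The shear as an algebra automorphism of `ℂ[c, b]`. [folklore] -/
def shearEquiv : MvPolynomial (Option ι) ℂ ≃ₐ[ℂ] MvPolynomial (Option ι) ℂ :=
  AlgEquiv.ofAlgHom (shear v) (shear (-v)) (shear_comp_shear_neg v)
    (by simpa using shear_comp_shear_neg (-v))

/-- `lineRestr v` is `rename some` followed by the shear and the identification
`ℂ[c, b] ≅ (ℂ[b])[X]` (`optionEquivLeft`). [folklore] -/
private theorem lineRestr_eq_comp :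
    lineRestr v = ((optionEquivLeft ℂ ι : MvPolynomial (Option ι) ℂ →ₐ[ℂ] (MvPolynomial ι ℂ)[X]).comp
      (shear v)).comp (rename some) := by
  refine MvPolynomial.algHom_ext fun k => ?_
  simp only [lineRestr_X, AlgHom.comp_apply, rename_X, shear_X_some, map_add, map_mul]
  change _ = optionEquivLeft ℂ ι (X (some k)) + optionEquivLeft ℂ ι (C (v k)) * optionEquivLeft ℂ ι (X none)
  rw [optionEquivLeft_X_some, optionEquivLeft_C, optionEquivLeft_X_none]

/-- Pointwise form of `lineRestr_eq_comp`. [folklore] -/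
private theorem lineRestr_apply (f : MvPolynomial ι ℂ) :
    lineRestr v f = optionEquivLeft ℂ ι (shearEquiv v (rename some f)) := by
  rw [lineRestr_eq_comp]; rfl

/-- `optionEquivLeft` sends a polynomial in the `b`-variables alone to a constant. [folklore] -/
private theorem optionEquivLeft_rename_some (g : MvPolynomial ι ℂ) :
    optionEquivLeft ℂ ι (rename some g) = Polynomial.C g := by
  induction g using MvPolynomial.induction_on with
  | C r => rw [rename_C, optionEquivLeft_C]
  | add p q hp hq => rw [map_add, map_add, hp, hq, map_add]
  | mul_X p i hp => rw [map_mul, map_mul, hp, rename_X, optionEquivLeft_X_some, map_mul]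

/-- A constant `C r` of `R[X]` is irreducible when `r` is (`R` a domain). [folklore] -/
private theorem irreducible_C_of_irreducible {R : Type*} [CommRing R] [IsDomain R] {r : R}
    (hr : Irreducible r) : Irreducible (Polynomial.C r) := by
  refine ⟨fun hu => hr.not_isUnit (Polynomial.isUnit_C.1 hu), fun a b hab => ?_⟩
  have hr0 : Polynomial.C r ≠ 0 := fun h0 => hr.ne_zero (Polynomial.C_injective (by simpa using h0))
  have ha0 : a ≠ 0 := fun h0 => hr0 (by rw [hab, h0, zero_mul])
  have hb0 : b ≠ 0 := fun h0 => hr0 (by rw [hab, h0, mul_zero])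
  have hdeg : a.natDegree + b.natDegree = 0 := by
    rw [← Polynomial.natDegree_mul ha0 hb0, ← hab, Polynomial.natDegree_C]
  have ha := Polynomial.eq_C_of_natDegree_eq_zero (show a.natDegree = 0 by omega)
  have hb := Polynomial.eq_C_of_natDegree_eq_zero (show b.natDegree = 0 by omega)
  rw [ha, hb, ← map_mul] at hab
  rcases hr.isUnit_or_isUnit (Polynomial.C_injective hab) with h | h
  · left; rw [ha]; exact Polynomial.isUnit_C.2 h
  · right; rw [hb]; exact Polynomial.isUnit_C.2 h

/-- **`lineRestr v h` is irreducible for irreducible `h`** (it is the image of the constant `C h` of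
`(ℂ[b])[X]` under ring isomorphisms; Gauss's lemma setting of the resultant criterion).
[cite: Shafarevich1994, Book 1 I §3.1 (resultants of irreducible polynomials)] -/
theorem irreducible_lineRestr {f : MvPolynomial ι ℂ} (hf : Irreducible f) : Irreducible (lineRestr v f) := by
  rw [lineRestr_apply]
  refine (MulEquiv.irreducible_iff (optionEquivLeft ℂ ι).toMulEquiv).2
    ((MulEquiv.irreducible_iff (shearEquiv v).toMulEquiv).2 ?_)
  have : rename some f = (optionEquivLeft ℂ ι).symm (Polynomial.C f) := by
    rw [AlgEquiv.eq_symm_apply, optionEquivLeft_rename_some]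
  rw [this]
  exact (MulEquiv.irreducible_iff (optionEquivLeft ℂ ι).symm.toMulEquiv).2 (irreducible_C_of_irreducible hf)

/-- `lineRestr v` is injective. [folklore] -/
private theorem lineRestr_injective : Function.Injective (lineRestr v) := by
  intro f g hfg
  rw [lineRestr_apply, lineRestr_apply] at hfg
  exact rename_injective some (Option.some_injective ι)
    ((shearEquiv v).injective ((optionEquivLeft ℂ ι).injective hfg))

/-- **Associated restrictions come from associated polynomials.** [folklore] -/
private theorem associated_of_associated_lineRestr {f g : MvPolynomial ι ℂ}
    (h : Associated (lineRestr v f) (lineRestr v g)) : Associated f g := by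
  obtain ⟨u, hu⟩ := h
  obtain ⟨r, hr, hru⟩ := Polynomial.isUnit_iff.1 u.isUnit
  obtain ⟨a, ha, rfl⟩ := MvPolynomial.isUnit_iff_eq_C_of_isReduced.1 hr
  have hfg : lineRestr v (f * C a) = lineRestr v g := by
    rw [map_mul, lineRestr_C, hru, hu]
  have := lineRestr_injective v hfg
  exact ⟨(MvPolynomial.isUnit_iff_eq_C_of_isReduced.2 ⟨a, ha, rfl⟩).unit, by simpa using this⟩

end LineRestriction

/-! ### Good lines: simple roots on single components -/

section GoodLines

/-- A restriction of `X`-degree `0` is the constant `C h`: `h(b + c v) = h(b)` for all `b, c`. [folklore] -/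
private theorem eval_eq_of_natDegree_eq_zero {v : ι → ℂ} {f : MvPolynomial ι ℂ}
    (hf : (lineRestr v f).natDegree = 0) (b : ι → ℂ) (c : ℂ) :
    MvPolynomial.eval (b + c • v) f = MvPolynomial.eval b f := by
  have key : ∀ c' : ℂ, MvPolynomial.eval (b + c' • v) f = MvPolynomial.eval b ((lineRestr v f).coeff 0) := by
    intro c'
    rw [← eval_eval_lineRestr, Polynomial.eq_C_of_natDegree_eq_zero hf, Polynomial.map_C, Polynomial.eval_C]
    simp
  rw [key, ← key 0, zero_smul, add_zero]

/-- **Bézout for the restrictions**: if `Res_X(𝔣, 𝔤)(b) ≠ 0` (formal degrees the `X`-degrees,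
`deg 𝔣 ≠ 0`) then `𝔣(b, ·)` and `𝔤(b, ·)` have no common root. [cite: Shafarevich1994, Book 1 I §3.1 (characteristic property of the resultant)] -/
private theorem not_common_root_of_resultant {b : ι → ℂ} {F G : (MvPolynomial ι ℂ)[X]}
    (hF : F.natDegree ≠ 0) (hres : MvPolynomial.eval b (Polynomial.resultant F G) ≠ 0) (c : ℂ)
    (hFc : Polynomial.eval c (F.map (MvPolynomial.eval b)) = 0) :
    Polynomial.eval c (G.map (MvPolynomial.eval b)) ≠ 0 := by
  obtain ⟨p, q, -, -, hpq⟩ := Polynomial.exists_mul_add_mul_eq_C_resultant F G le_rfl le_rfl (Or.inl hF)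
  intro hGc
  apply hres
  have := congrArg (fun P => Polynomial.eval c (P.map (MvPolynomial.eval b))) hpq
  simp only [Polynomial.map_add, Polynomial.map_mul, Polynomial.eval_add, Polynomial.eval_mul, hFc, hGc,
    zero_mul, zero_add, Polynomial.map_C, Polynomial.eval_C] at this
  exact this.symm

/-- `Res_X(𝔣, 𝔣') ≠ 0` for `𝔣 = lineRestr v h`, `h` irreducible, of positive `X`-degree
(else `𝔣 ∣ 𝔣'`, Gauss). [cite: Shafarevich1994, Book 1 I §3.1] -/
private theorem resultant_derivative_ne_zero {v : ι → ℂ} {f : MvPolynomial ι ℂ} (hf : Irreducible f)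
    (hdeg : (lineRestr v f).natDegree ≠ 0) :
    Polynomial.resultant (lineRestr v f) (Polynomial.derivative (lineRestr v f)) ≠ 0 := by
  intro hres
  have hdvd := Polynomial.dvd_of_resultant_eq_zero_of_irreducible (FractionRing (MvPolynomial ι ℂ))
    (irreducible_lineRestr v hf) hdeg hres
  have hd0 : Polynomial.derivative (lineRestr v f) ≠ 0 := fun h0 =>
    hdeg ((Polynomial.derivative_eq_zero).1 h0)
  have h1 := Polynomial.natDegree_le_of_dvd hdvd hd0
  have h2 := Polynomial.natDegree_derivative_lt hdeg
  omega

/-- `Res_X(𝔣ᵢ, 𝔣ⱼ) ≠ 0` for non-associated irreducible `hᵢ, hⱼ` with `deg_X 𝔣ᵢ ≠ 0`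
(else `𝔣ᵢ ∣ 𝔣ⱼ`, so `𝔣ᵢ ~ 𝔣ⱼ` and `hᵢ ~ hⱼ`). [cite: Shafarevich1994, Book 1 I §3.1] -/
private theorem resultant_ne_zero_of_not_associated {v : ι → ℂ} {f g : MvPolynomial ι ℂ}
    (hf : Irreducible f) (hg : Irreducible g) (hfg : ¬ Associated f g)
    (hdeg : (lineRestr v f).natDegree ≠ 0) :
    Polynomial.resultant (lineRestr v f) (lineRestr v g) ≠ 0 := by
  intro hres
  have hdvd := Polynomial.dvd_of_resultant_eq_zero_of_irreducible (FractionRing (MvPolynomial ι ℂ))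
    (irreducible_lineRestr v hf) hdeg hres
  exact hfg (associated_of_associated_lineRestr v
    ((irreducible_lineRestr v hf).associated_of_dvd (irreducible_lineRestr v hg) hdvd))

variable [Fintype ι] {m : ℕ} (h : Fin m → MvPolynomial ι ℂ)

/-- **A good line** `c ↦ b + c v` for `H = ⋃ V(hⱼ)`: every intersection is a SIMPLE root
(`Σ_k ∂_k hⱼ(b + cv) v_k ≠ 0`, the transversality of the straight disc of a meridian) lying on a
SINGLE component — Shimada's transversal discs, along a whole line. [cite: Shimada2010ZvK, §3 (transversal discs)] -/
def LineGood (b v : ι → ℂ) : Prop :=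
  ∀ (j : Fin m) (c : ℂ), MvPolynomial.eval (b + c • v) (h j) = 0 →
    (∑ k, MvPolynomial.eval (b + c • v) (pderiv k (h j)) * v k ≠ 0) ∧
      ∀ i, i ≠ j → MvPolynomial.eval (b + c • v) (h i) ≠ 0

variable {h}

/-- **For every direction the bad base points lie on a proper algebraic hypersurface.**  For
irreducible, pairwise non-associated `hⱼ` and any direction `v` there is a NON-ZERO polynomial
`P` in the base point `b` such that the line `c ↦ b + c v` is good whenever `P(b) ≠ 0` (`P` = the
product of the resultants `Res_X(𝔣ⱼ, 𝔣ⱼ')`, `Res_X(𝔣ᵢ, 𝔣ⱼ)`, with `hⱼ` itself in the degenerate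
case `deg_X 𝔣ⱼ = 0`). [cite: Shimada2010ZvK, §3 (existence of transversal discs)]
[cite: Shafarevich1994, Book 1 I §3.1 (resultants)] -/
theorem exists_polynomial_lineGood (hirr : ∀ j, Irreducible (h j))
    (hsep : ∀ i j, i ≠ j → ¬ Associated (h i) (h j)) (v : ι → ℂ) :
    ∃ P : MvPolynomial ι ℂ, P ≠ 0 ∧ ∀ b, MvPolynomial.eval b P ≠ 0 → LineGood h b v := by
  classical
  -- the factors
  let Pj : Fin m → MvPolynomial ι ℂ := fun j =>
    if (lineRestr v (h j)).natDegree = 0 then h j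
    else Polynomial.resultant (lineRestr v (h j)) (Polynomial.derivative (lineRestr v (h j)))
  let Qij : Fin m → Fin m → MvPolynomial ι ℂ := fun i j =>
    if i = j then 1 else if (lineRestr v (h i)).natDegree = 0 then h i
    else Polynomial.resultant (lineRestr v (h i)) (lineRestr v (h j))
  have hPj : ∀ j, Pj j ≠ 0 := by
    intro j
    simp only [Pj]
    split_ifs with hdeg
    · exact (hirr j).ne_zero
    · exact resultant_derivative_ne_zero (hirr j) hdeg
  have hQij : ∀ i j, Qij i j ≠ 0 := by
    intro i j
    simp only [Qij]
    split_ifs with hij hdeg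
    · exact one_ne_zero
    · exact (hirr i).ne_zero
    · exact resultant_ne_zero_of_not_associated (hirr i) (hirr j) (hsep i j hij) hdeg
  refine ⟨(∏ j, Pj j) * ∏ i, ∏ j, Qij i j, ?_, fun b hb => ?_⟩
  · exact mul_ne_zero (Finset.prod_ne_zero_iff.2 fun j _ => hPj j)
      (Finset.prod_ne_zero_iff.2 fun i _ => Finset.prod_ne_zero_iff.2 fun j _ => hQij i j)
  -- at a point where no factor vanishes, the line is good
  rw [map_mul, map_prod, mul_ne_zero_iff, Finset.prod_ne_zero_iff] at hb
  simp_rw [map_prod, Finset.prod_ne_zero_iff] at hb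
  obtain ⟨hbP, hbQ⟩ := hb
  intro j c hjc
  have hjc' : Polynomial.eval c ((lineRestr v (h j)).map (MvPolynomial.eval b)) = 0 := by
    rwa [eval_eval_lineRestr]
  -- the component `j` is met with positive `X`-degree
  have hdegj : (lineRestr v (h j)).natDegree ≠ 0 := by
    intro hdeg
    have hP := hbP j (Finset.mem_univ j)
    simp only [Pj, hdeg, ↓reduceIte] at hP
    rw [eval_eq_of_natDegree_eq_zero hdeg] at hjc
    exact hP hjc
  refine ⟨?_, fun i hij => ?_⟩
  · -- simple root
    have hP := hbP j (Finset.mem_univ j)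
    simp only [Pj, hdegj, ↓reduceIte] at hP
    have := not_common_root_of_resultant hdegj hP c hjc'
    rwa [eval_eval_derivative_lineRestr] at this
  · -- no other component
    have hQ := hbQ i (Finset.mem_univ i) j (Finset.mem_univ j)
    simp only [Qij, hij, ↓reduceIte] at hQ
    split_ifs at hQ with hdegi
    · rw [eval_eq_of_natDegree_eq_zero hdegi]; exact hQ
    · have := not_common_root_of_resultant (G := lineRestr v (h j)) hdegi hQ c
      rw [eval_eval_lineRestr, eval_eval_lineRestr] at this
      exact fun hi => this hi hjc

/-- The good base points for a fixed direction contain a dense open set. [cite: Shimada2010ZvK, §3 (existence of transversal discs)] -/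
theorem exists_isOpen_dense_subset_lineGood (hirr : ∀ j, Irreducible (h j))
    (hsep : ∀ i j, i ≠ j → ¬ Associated (h i) (h j)) (v : ι → ℂ) :
    ∃ D : Set (ι → ℂ), IsOpen D ∧ Dense D ∧ D ⊆ {b | LineGood h b v} := by
  obtain ⟨P, hP0, hP⟩ := exists_polynomial_lineGood hirr hsep v
  refine ⟨{b | MvPolynomial.eval b P ≠ 0}, isOpen_ne_fun (MvPolynomial.continuous_eval P) continuous_const,
    ?_, fun b hb => hP b hb⟩
  rw [dense_iff_inter_open]
  intro O hO hne
  by_contra hc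
  apply hP0
  refine Literature.NumberTheory.Transcendental.Nesterenko.eq_zero_of_eval_eq_zero_of_isOpen P hO hne
    fun z hz => ?_
  by_contra hz'
  exact hc ⟨z, hz, hz'⟩

/-- **Generic base points.** For irreducible, pairwise non-associated `hⱼ`, every non-empty open
subset of `ℂ^ι` contains a point `b` such that ALL the lines `c ↦ b + c v`, `v` in a countable dense
set of directions, are good (Baire: intersect the countably many dense open sets of good base
points). [cite: Shimada2010ZvK, §3 (existence of transversal discs)] -/
theorem exists_generic_basePoint (hirr : ∀ j, Irreducible (h j))
    (hsep : ∀ i j, i ≠ j → ¬ Associated (h i) (h j)) {O : Set (ι → ℂ)} (hO : IsOpen O)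
    (hne : O.Nonempty) :
    ∃ b ∈ O, ∃ S : Set (ι → ℂ), S.Countable ∧ Dense S ∧ ∀ v ∈ S, LineGood h b v := by
  obtain ⟨S, hSc, hSd⟩ := TopologicalSpace.exists_countable_dense (ι → ℂ)
  choose D hDo hDd hDsub using fun v : ι → ℂ => exists_isOpen_dense_subset_lineGood hirr hsep v
  have hdense : Dense (⋂ v ∈ S, D v) := dense_biInter_of_isOpen (fun v _ => hDo v) hSc (fun v _ => hDd v)
  obtain ⟨b, hb, hbO⟩ := hdense.exists_mem_open hO hne
  exact ⟨b, hbO, S, hSc, hSd, fun v hv => hDsub v (Set.mem_iInter₂.1 hb v hv)⟩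

end GoodLines

end Literature.AlgebraicGeometry.FundamentalGroup
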